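import Summits.BirchSwinnertonDyer.BirchSwinnertonDyer.Theorems.Rank2ObservatoryPadicAtlasKitR3
import HarnessLib

/-!
# Rank-2 observatory — `p`-adic atlas kit, FAST (row-indexed) kernel test of a cell

HONEST FRAMING: per-curve certified theorems and census instruments; no claim on BSD in rank ≥ 2.

The kernel tests `AtlasCell.check` (`r = 2`, `Rank2ObservatoryPadicAtlasKit.lean`) and
`AtlasCell.check3` (`r = 3`, `…KitR3.lean`) evaluate `SymbolCertL.validL`, whose double sums
`isumL` read the plus-symbol table `tab : List ℤ` by `tab.getD u 0` — `O(u)` kernel reductions per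
read, `O(p^{2(n+1)})` per cell: fine up to `p^{n+1} = 625` entries, but the kernel runs out of memory at
`p^{n+1} = 1331` (so the `26` two-engine rank-3 cells with `p^{n+1} ∈ {1331, 2197, 2401, 3125}` could
not be certified). This file adds an EQUIVALENT test that first cuts the table into rows of length
`m = p^{⌊(n+1)/2⌋}` (`rowsOf`, structural recursion on a fuel argument) and reads entry `u` as
`rows[u / m][u % m]` (`getD2`): `O(p^{(n+1)/2})` reductions per read.

* `getD2_rowsOf`: `getD2 (rowsOf fuel m l) m i = l.getD i 0` whenever `l.length ≤ fuel · m` (`m > 0`);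
* `isumF` = `isumL` with `getD2` reads (and an optional period for the level-`p^n` table), with
  `isumF_rowsOf_eq_isumL`, `isumF_rowsOf_eq_isumL_certL`, `isumF_rowsOf_eq_isumL_certL3`;
* `AtlasCell.validF r` (the conjunction of `SymbolCertL.validL`, sums by `isumF`), `AtlasCell.checkF`
  (`r = 2`) and `AtlasCell.check3F` (`r = 3`) with `check_of_checkF`, `check3_of_check3F`;
* `AtlasCurve.checkF` / `AtlasCurve3.checkF` with `check_of_checkF` and the per-curve transfer lemmas
  `AtlasCurve.ok_of_okF`, `AtlasCurve3.ok_of_okF` (`(C.checkF && b) = true → (C.check && b) = true`),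
  so that an atlas part proves `c<label>_ok` from a kernel `decide` of the FAST test and is otherwise
  byte-for-byte the shape of the existing parts (same tables, same consequence theorems).

No new hypotheses, no change of any statement about symbols; no new axioms, no `sorry`.

References: B. Mazur, J. Tate, J. Teitelbaum, Invent. Math. 84 (1986), §I.10–I.13 (the Riemann sums);
W. Stein, C. Wuthrich, Math. Comp. 82 (2013), §3.
-/

-- single-conjunct summit: `Summit.BirchSwinnertonDyer.BirchSwinnertonDyer.…` repeats the name by design
set_option linter.dupNamespace false

namespace Summit.BirchSwinnertonDyer.BirchSwinnertonDyer.Rank2Observatory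

open Literature.NumberTheory.EllipticCurves Literature.NumberTheory.EllipticCurves.ModularForms
  WeierstrassCurve
open Literature.NumberTheory.Sieve.GoldbachLinnik (primeB prime_of_primeB)

/-! ### Row-indexed tables -/

/-- Cut a list into consecutive rows of length `m` (at most `fuel` rows; structural recursion on the
fuel, so that the kernel evaluates it by plain unfolding). [folklore] -/
def rowsOf : ℕ → ℕ → List ℤ → List (List ℤ)
  | 0, _, _ => []
  | fuel + 1, m, l => l.take m :: rowsOf fuel m (l.drop m)

/-- Two-level read: entry `i` of the flattened rows is `rows[i / m][i % m]` (default `0`). [folklore] -/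
def getD2 (rows : List (List ℤ)) (m i : ℕ) : ℤ :=
  (rows.getD (i / m) []).getD (i % m) 0

/-- **The two-level read IS the flat read**: `getD2 (rowsOf fuel m l) m i = l.getD i 0` when the fuel
covers the list (`l.length ≤ fuel · m`, `m > 0`). [folklore] -/
theorem getD2_rowsOf {m : ℕ} (hm : 0 < m) :
    ∀ (fuel : ℕ) (l : List ℤ) (i : ℕ), l.length ≤ fuel * m → getD2 (rowsOf fuel m l) m i = l.getD i 0
  | 0, l, i, h => by
    have hl : l = [] := List.eq_nil_of_length_eq_zero (by omega)
    subst hl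
    simp [getD2, rowsOf]
  | fuel + 1, l, i, h => by
    by_cases hi : i < m
    · rw [getD2, rowsOf, Nat.div_eq_of_lt hi, Nat.mod_eq_of_lt hi, List.getD_cons_zero,
        List.getD_eq_getElem?_getD, List.getD_eq_getElem?_getD, List.getElem?_take_of_lt hi]
    · have him : m ≤ i := not_lt.mp hi
      have hlen : (l.drop m).length ≤ fuel * m := by
        rw [List.length_drop, Nat.succ_mul] at *
        omega
      have ih := getD2_rowsOf hm fuel (l.drop m) (i - m) hlen
      rw [getD2] at ih
      rw [getD2, rowsOf, Nat.div_eq_sub_div hm him, Nat.mod_eq_sub_mod him, List.getD_cons_succ, ih,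
        List.getD_eq_getElem?_getD, List.getD_eq_getElem?_getD, List.getElem?_drop]
      congr 2
      omega

/-! ### The double sums with two-level reads -/

section Sums

variable (p : ℕ) [Fact p.Prime]

/-- The integer double sum of `isumL`, reading the table through `getD2` (rows of length `m`), the
index taken modulo `period` (`period = 0`: no reduction; `period = p^n`: the level-`p^n` table).
[cite: MazurTateTeitelbaum1986Invent, §I.10–I.13] -/
def isumF (n m : ℕ) (rows : List (List ℤ)) (period k : ℕ) : ℤ :=
  ∑ y ∈ teichSet p (n + 1), ∑ s : ZMod (p ^ n),
    getD2 rows m ((y * ((1 + p : ℕ) : ZMod (p ^ (n + 1))) ^ s.val).val % period) * (s.val.choose k : ℤ)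

/-- `isumF` over the rows of `tab` (no period) IS `isumL tab`. [folklore] -/
theorem isumF_rowsOf_eq_isumL {m : ℕ} (hm : 0 < m) (n fuel : ℕ) (tab : List ℤ)
    (h : tab.length ≤ fuel * m) (k : ℕ) :
    isumF p n m (rowsOf fuel m tab) 0 k = isumL p n tab k := by
  unfold isumF isumL
  refine Finset.sum_congr rfl fun y _ => Finset.sum_congr rfl fun s _ => ?_
  rw [Nat.mod_zero, getD2_rowsOf hm fuel tab _ h]

end Sums

namespace AtlasCell

variable (c : AtlasCell)

/-- The row length of the fast test: `p^{⌊(n+1)/2⌋}`. [folklore] -/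
def rowLen : ℕ := c.p ^ ((c.n + 1) / 2)

/-- `isumF` over the rows of the period-`p^n` table, indices reduced mod `p^n`, IS `isumL` of the
expanded table of `certL` (`r = 2`). [folklore] -/
theorem isumF_rowsOf_eq_isumL_certL [Fact c.p.Prime] {m : ℕ} (hm : 0 < m) (fuel : ℕ)
    (h : c.tabLo.length ≤ fuel * m) (k : ℕ) :
    isumF c.p c.n m (rowsOf fuel m c.tabLo) (c.p ^ c.n) k = isumL c.p c.n c.certL.tabLo k := by
  haveI : NeZero (c.p ^ (c.n + 1)) := ⟨pow_ne_zero _ (Fact.out : c.p.Prime).ne_zero⟩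
  unfold isumF isumL
  refine Finset.sum_congr rfl fun y _ => Finset.sum_congr rfl fun s _ => ?_
  rw [getD2_rowsOf hm fuel _ _ h, c.certL_tabLo_getD (ZMod.val_lt _)]

/-- The same for the `r = 3` certificate `certL3`. [folklore] -/
theorem isumF_rowsOf_eq_isumL_certL3 [Fact c.p.Prime] {m : ℕ} (hm : 0 < m) (fuel : ℕ)
    (h : c.tabLo.length ≤ fuel * m) (k : ℕ) :
    isumF c.p c.n m (rowsOf fuel m c.tabLo) (c.p ^ c.n) k = isumL c.p c.n c.certL3.tabLo k := by
  haveI : NeZero (c.p ^ (c.n + 1)) := ⟨pow_ne_zero _ (Fact.out : c.p.Prime).ne_zero⟩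
  unfold isumF isumL
  refine Finset.sum_congr rfl fun y _ => Finset.sum_congr rfl fun s _ => ?_
  rw [getD2_rowsOf hm fuel _ _ h, c.certL3_tabLo_getD (ZMod.val_lt _)]

/-- **The FAST validity test of a cell with order `r`**: the conjunction of `SymbolCertL.validL`
(`p ≠ 2`, `p ∤ r!`, `p^n ∣ A² − a_p A + p`, `p ∤ A`, `p^n ∤ A·H − L`, `#teichSet = τ`, unit classes,
`ΣHi = H`, `ΣLo = L`) with the sums evaluated by `isumF` over rows of length `rowLen`.
[cite: MazurTateTeitelbaum1986Invent, §I.10–I.13] -/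
def validF (r : ℕ) [Fact c.p.Prime] : Bool :=
  decide (c.p ≠ 2 ∧ ¬ c.p ∣ r.factorial ∧ (c.p : ℤ) ^ c.n ∣ c.A ^ 2 - c.ap * c.A + c.p ∧
    ¬ (c.p : ℤ) ∣ c.A ∧ ¬ (c.p : ℤ) ^ c.n ∣ c.A * c.H - c.L ∧
    (teichSet c.p (c.n + 1)).card = torsionOrder c.p ∧
    (∀ y ∈ teichSet c.p (c.n + 1), ∀ s : ZMod (c.p ^ c.n),
      ¬ c.p ∣ (y * ((1 + c.p : ℕ) : ZMod (c.p ^ (c.n + 1))) ^ s.val).val) ∧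
    isumF c.p c.n c.rowLen (rowsOf c.tabHi.length c.rowLen c.tabHi) 0 r = c.H ∧
    isumF c.p c.n c.rowLen (rowsOf c.tabLo.length c.rowLen c.tabLo) (c.p ^ c.n) r = c.L)

variable {c}

/-- The row length is positive. [folklore] -/
theorem rowLen_pos [Fact c.p.Prime] : 0 < c.rowLen :=
  pow_pos (Fact.out : c.p.Prime).pos _

/-- **Fast test ⟹ `validL` of the `r = 2` certificate `certL`.** [folklore] -/
theorem validL_certL_of_validF [Fact c.p.Prime] (h : c.validF 2 = true) :
    c.certL.validL c.p c.ap = true := by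
  have hm := rowLen_pos (c := c)
  have hHi : c.tabHi.length ≤ c.tabHi.length * c.rowLen := Nat.le_mul_of_pos_right _ hm
  have hLo : c.tabLo.length ≤ c.tabLo.length * c.rowLen := Nat.le_mul_of_pos_right _ hm
  simp only [validF, decide_eq_true_eq] at h
  obtain ⟨h1, h2, h3, h4, h5, h6, h7, h8, h9⟩ := h
  rw [isumF_rowsOf_eq_isumL c.p hm _ _ _ hHi] at h8
  rw [isumF_rowsOf_eq_isumL_certL c hm _ hLo] at h9
  simp only [SymbolCertL.validL, decide_eq_true_eq]
  exact ⟨h1, h2, h3, h4, h5, h6, h7, h8, h9⟩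

/-- **Fast test ⟹ `validL` of the `r = 3` certificate `certL3`.** [folklore] -/
theorem validL_certL3_of_validF [Fact c.p.Prime] (h : c.validF 3 = true) :
    c.certL3.validL c.p c.ap = true := by
  have hm := rowLen_pos (c := c)
  have hHi : c.tabHi.length ≤ c.tabHi.length * c.rowLen := Nat.le_mul_of_pos_right _ hm
  have hLo : c.tabLo.length ≤ c.tabLo.length * c.rowLen := Nat.le_mul_of_pos_right _ hm
  simp only [validF, decide_eq_true_eq] at h
  obtain ⟨h1, h2, h3, h4, h5, h6, h7, h8, h9⟩ := h
  rw [isumF_rowsOf_eq_isumL c.p hm _ _ _ hHi] at h8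
  rw [isumF_rowsOf_eq_isumL_certL3 c hm _ hLo] at h9
  simp only [SymbolCertL.validL, decide_eq_true_eq]
  exact ⟨h1, h2, h3, h4, h5, h6, h7, h8, h9⟩

variable (c)

/-- **The FAST kernel test of a cell, `r = 2`** (same conjuncts as `AtlasCell.check`, the certificate
validity by `validF 2`). [folklore] -/
def checkF (e : WeierstrassCurve ℤ) : Bool :=
  decide (5 ≤ c.p) && decide (¬ ((c.p : ℤ) ∣ e.Δ)) && decide ((c.count e : ℤ) = c.p + 1 - c.ap) &&
    decide (¬ ((c.p : ℤ) ∣ c.ap)) &&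
    if hp : primeB c.p = true then @validF c 2 ⟨prime_of_primeB hp⟩ else false

/-- **The FAST kernel test of a cell, `r = 3`** (same conjuncts as `AtlasCell.check3`, the certificate
validity by `validF 3`). [folklore] -/
def check3F (e : WeierstrassCurve ℤ) : Bool :=
  decide (5 ≤ c.p) && decide (¬ ((c.p : ℤ) ∣ e.Δ)) && decide ((c.count e : ℤ) = c.p + 1 - c.ap) &&
    decide (¬ ((c.p : ℤ) ∣ c.ap)) &&
    if hp : primeB c.p = true then @validF c 3 ⟨prime_of_primeB hp⟩ else false

variable {c} {e : WeierstrassCurve ℤ}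

/-- Fast test ⟹ test, `r = 2`. [folklore] -/
theorem check_of_checkF (h : c.checkF e = true) : c.check e = true := by
  unfold checkF at h
  unfold check
  simp only [Bool.and_eq_true] at h ⊢
  refine ⟨h.1, ?_⟩
  by_cases hp : primeB c.p = true
  · rw [dif_pos hp] at h ⊢
    exact @validL_certL_of_validF c ⟨prime_of_primeB hp⟩ h.2
  · rw [dif_neg hp] at h
    exact absurd h.2 Bool.false_ne_true

/-- Fast test ⟹ test, `r = 3`. [folklore] -/
theorem check3_of_check3F (h : c.check3F e = true) : c.check3 e = true := by
  unfold check3F at h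
  unfold check3
  simp only [Bool.and_eq_true] at h ⊢
  refine ⟨h.1, ?_⟩
  by_cases hp : primeB c.p = true
  · rw [dif_pos hp] at h ⊢
    exact @validL_certL3_of_validF c ⟨prime_of_primeB hp⟩ h.2
  · rw [dif_neg hp] at h
    exact absurd h.2 Bool.false_ne_true

end AtlasCell

namespace AtlasCurve

/-- **The FAST kernel test of a rank-2 atlas curve**: `Δ ≠ 0` and every cell passes `checkF`.
[folklore] -/
def checkF (C : AtlasCurve) : Bool :=
  decide (C.e.Δ ≠ 0) && C.cells.all fun c => c.checkF C.e

variable {C : AtlasCurve}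

/-- Fast test ⟹ test (rank-2 curve). [folklore] -/
theorem check_of_checkF (h : C.checkF = true) : C.check = true := by
  simp only [checkF, check, Bool.and_eq_true, List.all_eq_true] at h ⊢
  exact ⟨h.1, fun c hc => AtlasCell.check_of_checkF (h.2 c hc)⟩

/-- Per-curve certificate transfer: a kernel `decide` of `(C.checkF && b)` gives `(C.check && b)`
(`b` = the minimality test of the part). [folklore] -/
theorem ok_of_okF {b : Bool} (h : (C.checkF && b) = true) : (C.check && b) = true := by
  simp only [Bool.and_eq_true] at h ⊢
  exact ⟨check_of_checkF h.1, h.2⟩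

end AtlasCurve

namespace AtlasCurve3

/-- **The FAST kernel test of a rank-3 atlas curve**: `Δ ≠ 0` and every cell passes `check3F`.
[folklore] -/
def checkF (C : AtlasCurve3) : Bool :=
  decide (C.e.Δ ≠ 0) && C.cells.all fun c => c.check3F C.e

variable {C : AtlasCurve3}

/-- Fast test ⟹ test (rank-3 curve). [folklore] -/
theorem check_of_checkF (h : C.checkF = true) : C.check = true := by
  simp only [checkF, check, Bool.and_eq_true, List.all_eq_true] at h ⊢
  exact ⟨h.1, fun c hc => AtlasCell.check3_of_check3F (h.2 c hc)⟩

/-- Per-curve certificate transfer: a kernel `decide` of `(C.checkF && b)` gives `(C.check && b)`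
(`b` = the minimality test of the part). [folklore] -/
theorem ok_of_okF {b : Bool} (h : (C.checkF && b) = true) : (C.check && b) = true := by
  simp only [Bool.and_eq_true] at h ⊢
  exact ⟨check_of_checkF h.1, h.2⟩

end AtlasCurve3

end Summit.BirchSwinnertonDyer.BirchSwinnertonDyer.Rank2Observatory
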